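import Mathlib
import HarnessLib
import Summits.ValiantsHypothesis.ValiantsHypothesis.Theorems.LacunarySymmetroidMatrixDescartesOsculationLawTwoK
import Summits.ValiantsHypothesis.ValiantsHypothesis.Theorems.LacunarySymmetroidMatrixDescartesOsculationLawThreeKThreeZeroPencil
import Summits.ValiantsHypothesis.ValiantsHypothesis.Theorems.LacunarySymmetroidMatrixDescartesOsculationLawCuspCubic
import Summits.ValiantsHypothesis.ValiantsHypothesis.Theorems.LacunarySymmetroidMatrixDescartesOsculationLawCuspCubicCount
import Summits.ValiantsHypothesis.ValiantsHypothesis.Theorems.LacunarySymmetroidMatrixDescartesOsculationLawCuspCubicSupport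

/-!
# ValiantsHypothesis / LacunarySymmetroid — crux `MatrixDescartes` (stmt-ValiantsHypothesis-18050, V1),
# line `Cruxes/MatrixDescartes/Lines/osculation_law.lean` («osculation-law»): the splitting `(r,s) = (3,0)` of the
# `m = 3` rung — symmetric `3 × 3` pencils with the FULL-RANK letter inserted

File 5/5 of the `(3,0)` piece (pencil lemmas `det_three_zero`, `insertionPoly_three_zero`, `hreal_three_zero`, `persist_three_zero` in `…ThreeKThreeZeroPencil`).  For a symmetric block pencil `G(t) = Σ_l t^(d l) S_l` on `Fin 3 ⊕ Fin 0` and the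
block projector `I₃ ⊕ 0 = 1`, the insertion polynomial is the MONIC CUBIC `Φ = det(G(t) + b·I₃) = b³ + σ₁b² + σ₂b + σ₃`
(`σ₁ = tr G`, `σ₂` = sum of the principal `2 × 2` minors, `σ₃ = det G`; `insertionPoly_three_zero`).  The two
analytic inputs of the abstract count `OsculationCuspCubic.cubic_curve_ncard_le` are discharged from the matrix
picture: REAL-ROOTEDNESS (`hreal_three_zero`: `Φ(t,b) = ∏ᵢ (b − μᵢ(t))` with `μᵢ(t)` the eigenvalues of the
symmetric matrix `−G(t)`, Mathlib `Matrix.IsHermitian.charpoly_eq` + `Matrix.eval_charpoly`) and ROOT PERSISTENCE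
(`persist_three_zero`: a positive root `b₀` of `Φ(t₀,·)` is a kernel vector `v` of `G(t₀) + b₀I`, so
`vᵀG(t₀)v < 0`; this open condition persists for `t` near `t₀`, where `G(t)` is then not positive semidefinite, has a
negative eigenvalue `λ` (`IsHermitian.posSemidef_iff_eigenvalues_nonneg`), and `b = −λ > 0` is a root of `Φ(t,·)` by the
eigenvector).  With the monomial supports `supp σᵢ ⊆ i • E` (`E` = the exponent set, `|E| ≤ K`):

* **`osc_three_zero`** — for every `K`, `d`, symmetric `S : Fin K → Matrix (Fin 3 ⊕ Fin 0) (Fin 3 ⊕ Fin 0) ℝ`, a finite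
  osculation set of the spectral curve has at most `17 · K ^ 41` points (the line's `OsculationLawAt 3 K ·`, splitting
  `r = 3, s = 0`, vocabulary UNFOLDED verbatim as in `OsculationTwoK.osc_two_zero`).

The `(0,3)`, `(1,2)` splittings are `OsculationLawRankZero/RankOne`-type theorems already in the tree and `(2,1)` is
val-lit-p5 g11's; the assembly `osculationLawAt_three` is theirs.  Honest framing: a located rung piece of an
UNREGISTERED V1 law line (ideator val-idea-2); `OsculationLaw` (all `m`), `PeelInequality`, `stub_recursion`,
`MatrixDescartes`, Conjecture B and `VP ≠ VNP` are OPEN / NOT proved; nothing here is progress on them; census +0.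
No definitions, no named facts; Mathlib + the line's files only.
-/

-- `Summit.ValiantsHypothesis.ValiantsHypothesis.…` is the tree's mandated single-conjunct layout (Sub = Summit).
set_option linter.dupNamespace false

noncomputable section

namespace Summit.ValiantsHypothesis.ValiantsHypothesis.Theorems.LacunarySymmetroidMatrixDescartes

open Polynomial Set
open scoped BigOperators Matrix Pointwise

namespace OsculationThreeK

/-! ### The `(3, 0)` splitting -/

set_option maxHeartbeats 4000000 in
/-- **The splitting `r = 3, s = 0` of `OsculationLawAt 3 K (17 · K ^ 41)`** (line vocabulary UNFOLDED verbatim as in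
`OsculationTwoK.osc_two_zero`): for every `K`, every `d : Fin K → ℕ` and every symmetric block pencil
`S : Fin K → Matrix (Fin 3 ⊕ Fin 0) (Fin 3 ⊕ Fin 0) ℝ`, a finite osculation set of the spectral curve
`det(Σ_l t^(d l) S_l + b·(I₃ ⊕ 0)) = 0` has at most `17 · K ^ 41` points. -/
theorem osc_three_zero (K : ℕ) (d : Fin K → ℕ) (S : Fin K → Matrix (Fin 3 ⊕ Fin 0) (Fin 3 ⊕ Fin 0) ℝ)
    (hS : ∀ l, (S l).IsSymm) (hfin : {p : Fin 2 → ℝ | 0 < p 0 ∧ 0 < p 1 ∧ MvPolynomial.eval p (∑ l, (MvPolynomial.X (0 : Fin 2) : MvPolynomial (Fin 2) ℝ) ^ d l •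
              (S l).map (MvPolynomial.C : ℝ →+* MvPolynomial (Fin 2) ℝ)
            + (MvPolynomial.X (1 : Fin 2) : MvPolynomial (Fin 2) ℝ) •
              (Matrix.fromBlocks 1 0 0 0 : Matrix (Fin 3 ⊕ Fin 0) (Fin 3 ⊕ Fin 0) ℝ).map
                (MvPolynomial.C : ℝ →+* MvPolynomial (Fin 2) ℝ)).det = 0 ∧
      MvPolynomial.eval p
        (MvPolynomial.X 0 * MvPolynomial.pderiv 0 (MvPolynomial.X 0 * MvPolynomial.pderiv 0 (∑ l, (MvPolynomial.X (0 : Fin 2) : MvPolynomial (Fin 2) ℝ) ^ d l •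
              (S l).map (MvPolynomial.C : ℝ →+* MvPolynomial (Fin 2) ℝ)
            + (MvPolynomial.X (1 : Fin 2) : MvPolynomial (Fin 2) ℝ) •
              (Matrix.fromBlocks 1 0 0 0 : Matrix (Fin 3 ⊕ Fin 0) (Fin 3 ⊕ Fin 0) ℝ).map
                (MvPolynomial.C : ℝ →+* MvPolynomial (Fin 2) ℝ)).det)
            * (MvPolynomial.X 1 * MvPolynomial.pderiv 1 (∑ l, (MvPolynomial.X (0 : Fin 2) : MvPolynomial (Fin 2) ℝ) ^ d l •
              (S l).map (MvPolynomial.C : ℝ →+* MvPolynomial (Fin 2) ℝ)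
            + (MvPolynomial.X (1 : Fin 2) : MvPolynomial (Fin 2) ℝ) •
              (Matrix.fromBlocks 1 0 0 0 : Matrix (Fin 3 ⊕ Fin 0) (Fin 3 ⊕ Fin 0) ℝ).map
                (MvPolynomial.C : ℝ →+* MvPolynomial (Fin 2) ℝ)).det) ^ 2
          - 2 * (MvPolynomial.X 0 * MvPolynomial.pderiv 0 (MvPolynomial.X 1 * MvPolynomial.pderiv 1 (∑ l, (MvPolynomial.X (0 : Fin 2) : MvPolynomial (Fin 2) ℝ) ^ d l •
              (S l).map (MvPolynomial.C : ℝ →+* MvPolynomial (Fin 2) ℝ)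
            + (MvPolynomial.X (1 : Fin 2) : MvPolynomial (Fin 2) ℝ) •
              (Matrix.fromBlocks 1 0 0 0 : Matrix (Fin 3 ⊕ Fin 0) (Fin 3 ⊕ Fin 0) ℝ).map
                (MvPolynomial.C : ℝ →+* MvPolynomial (Fin 2) ℝ)).det))
            * (MvPolynomial.X 0 * MvPolynomial.pderiv 0 (∑ l, (MvPolynomial.X (0 : Fin 2) : MvPolynomial (Fin 2) ℝ) ^ d l •
              (S l).map (MvPolynomial.C : ℝ →+* MvPolynomial (Fin 2) ℝ)
            + (MvPolynomial.X (1 : Fin 2) : MvPolynomial (Fin 2) ℝ) •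
              (Matrix.fromBlocks 1 0 0 0 : Matrix (Fin 3 ⊕ Fin 0) (Fin 3 ⊕ Fin 0) ℝ).map
                (MvPolynomial.C : ℝ →+* MvPolynomial (Fin 2) ℝ)).det) * (MvPolynomial.X 1 * MvPolynomial.pderiv 1 (∑ l, (MvPolynomial.X (0 : Fin 2) : MvPolynomial (Fin 2) ℝ) ^ d l •
              (S l).map (MvPolynomial.C : ℝ →+* MvPolynomial (Fin 2) ℝ)
            + (MvPolynomial.X (1 : Fin 2) : MvPolynomial (Fin 2) ℝ) •
              (Matrix.fromBlocks 1 0 0 0 : Matrix (Fin 3 ⊕ Fin 0) (Fin 3 ⊕ Fin 0) ℝ).map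
                (MvPolynomial.C : ℝ →+* MvPolynomial (Fin 2) ℝ)).det)
          + MvPolynomial.X 1 * MvPolynomial.pderiv 1 (MvPolynomial.X 1 * MvPolynomial.pderiv 1 (∑ l, (MvPolynomial.X (0 : Fin 2) : MvPolynomial (Fin 2) ℝ) ^ d l •
              (S l).map (MvPolynomial.C : ℝ →+* MvPolynomial (Fin 2) ℝ)
            + (MvPolynomial.X (1 : Fin 2) : MvPolynomial (Fin 2) ℝ) •
              (Matrix.fromBlocks 1 0 0 0 : Matrix (Fin 3 ⊕ Fin 0) (Fin 3 ⊕ Fin 0) ℝ).map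
                (MvPolynomial.C : ℝ →+* MvPolynomial (Fin 2) ℝ)).det)
            * (MvPolynomial.X 0 * MvPolynomial.pderiv 0 (∑ l, (MvPolynomial.X (0 : Fin 2) : MvPolynomial (Fin 2) ℝ) ^ d l •
              (S l).map (MvPolynomial.C : ℝ →+* MvPolynomial (Fin 2) ℝ)
            + (MvPolynomial.X (1 : Fin 2) : MvPolynomial (Fin 2) ℝ) •
              (Matrix.fromBlocks 1 0 0 0 : Matrix (Fin 3 ⊕ Fin 0) (Fin 3 ⊕ Fin 0) ℝ).map
                (MvPolynomial.C : ℝ →+* MvPolynomial (Fin 2) ℝ)).det) ^ 2) = 0}.Finite) :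
    {p : Fin 2 → ℝ | 0 < p 0 ∧ 0 < p 1 ∧ MvPolynomial.eval p (∑ l, (MvPolynomial.X (0 : Fin 2) : MvPolynomial (Fin 2) ℝ) ^ d l •
              (S l).map (MvPolynomial.C : ℝ →+* MvPolynomial (Fin 2) ℝ)
            + (MvPolynomial.X (1 : Fin 2) : MvPolynomial (Fin 2) ℝ) •
              (Matrix.fromBlocks 1 0 0 0 : Matrix (Fin 3 ⊕ Fin 0) (Fin 3 ⊕ Fin 0) ℝ).map
                (MvPolynomial.C : ℝ →+* MvPolynomial (Fin 2) ℝ)).det = 0 ∧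
      MvPolynomial.eval p
        (MvPolynomial.X 0 * MvPolynomial.pderiv 0 (MvPolynomial.X 0 * MvPolynomial.pderiv 0 (∑ l, (MvPolynomial.X (0 : Fin 2) : MvPolynomial (Fin 2) ℝ) ^ d l •
              (S l).map (MvPolynomial.C : ℝ →+* MvPolynomial (Fin 2) ℝ)
            + (MvPolynomial.X (1 : Fin 2) : MvPolynomial (Fin 2) ℝ) •
              (Matrix.fromBlocks 1 0 0 0 : Matrix (Fin 3 ⊕ Fin 0) (Fin 3 ⊕ Fin 0) ℝ).map
                (MvPolynomial.C : ℝ →+* MvPolynomial (Fin 2) ℝ)).det)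
            * (MvPolynomial.X 1 * MvPolynomial.pderiv 1 (∑ l, (MvPolynomial.X (0 : Fin 2) : MvPolynomial (Fin 2) ℝ) ^ d l •
              (S l).map (MvPolynomial.C : ℝ →+* MvPolynomial (Fin 2) ℝ)
            + (MvPolynomial.X (1 : Fin 2) : MvPolynomial (Fin 2) ℝ) •
              (Matrix.fromBlocks 1 0 0 0 : Matrix (Fin 3 ⊕ Fin 0) (Fin 3 ⊕ Fin 0) ℝ).map
                (MvPolynomial.C : ℝ →+* MvPolynomial (Fin 2) ℝ)).det) ^ 2
          - 2 * (MvPolynomial.X 0 * MvPolynomial.pderiv 0 (MvPolynomial.X 1 * MvPolynomial.pderiv 1 (∑ l, (MvPolynomial.X (0 : Fin 2) : MvPolynomial (Fin 2) ℝ) ^ d l •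
              (S l).map (MvPolynomial.C : ℝ →+* MvPolynomial (Fin 2) ℝ)
            + (MvPolynomial.X (1 : Fin 2) : MvPolynomial (Fin 2) ℝ) •
              (Matrix.fromBlocks 1 0 0 0 : Matrix (Fin 3 ⊕ Fin 0) (Fin 3 ⊕ Fin 0) ℝ).map
                (MvPolynomial.C : ℝ →+* MvPolynomial (Fin 2) ℝ)).det))
            * (MvPolynomial.X 0 * MvPolynomial.pderiv 0 (∑ l, (MvPolynomial.X (0 : Fin 2) : MvPolynomial (Fin 2) ℝ) ^ d l •
              (S l).map (MvPolynomial.C : ℝ →+* MvPolynomial (Fin 2) ℝ)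
            + (MvPolynomial.X (1 : Fin 2) : MvPolynomial (Fin 2) ℝ) •
              (Matrix.fromBlocks 1 0 0 0 : Matrix (Fin 3 ⊕ Fin 0) (Fin 3 ⊕ Fin 0) ℝ).map
                (MvPolynomial.C : ℝ →+* MvPolynomial (Fin 2) ℝ)).det) * (MvPolynomial.X 1 * MvPolynomial.pderiv 1 (∑ l, (MvPolynomial.X (0 : Fin 2) : MvPolynomial (Fin 2) ℝ) ^ d l •
              (S l).map (MvPolynomial.C : ℝ →+* MvPolynomial (Fin 2) ℝ)
            + (MvPolynomial.X (1 : Fin 2) : MvPolynomial (Fin 2) ℝ) •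
              (Matrix.fromBlocks 1 0 0 0 : Matrix (Fin 3 ⊕ Fin 0) (Fin 3 ⊕ Fin 0) ℝ).map
                (MvPolynomial.C : ℝ →+* MvPolynomial (Fin 2) ℝ)).det)
          + MvPolynomial.X 1 * MvPolynomial.pderiv 1 (MvPolynomial.X 1 * MvPolynomial.pderiv 1 (∑ l, (MvPolynomial.X (0 : Fin 2) : MvPolynomial (Fin 2) ℝ) ^ d l •
              (S l).map (MvPolynomial.C : ℝ →+* MvPolynomial (Fin 2) ℝ)
            + (MvPolynomial.X (1 : Fin 2) : MvPolynomial (Fin 2) ℝ) •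
              (Matrix.fromBlocks 1 0 0 0 : Matrix (Fin 3 ⊕ Fin 0) (Fin 3 ⊕ Fin 0) ℝ).map
                (MvPolynomial.C : ℝ →+* MvPolynomial (Fin 2) ℝ)).det)
            * (MvPolynomial.X 0 * MvPolynomial.pderiv 0 (∑ l, (MvPolynomial.X (0 : Fin 2) : MvPolynomial (Fin 2) ℝ) ^ d l •
              (S l).map (MvPolynomial.C : ℝ →+* MvPolynomial (Fin 2) ℝ)
            + (MvPolynomial.X (1 : Fin 2) : MvPolynomial (Fin 2) ℝ) •
              (Matrix.fromBlocks 1 0 0 0 : Matrix (Fin 3 ⊕ Fin 0) (Fin 3 ⊕ Fin 0) ℝ).map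
                (MvPolynomial.C : ℝ →+* MvPolynomial (Fin 2) ℝ)).det) ^ 2) = 0}.ncard ≤ 17 * K ^ 41 := by
  classical
  have hEK : (Finset.univ.image d).card ≤ K := (Finset.card_image_le).trans (by simp)
  obtain ⟨σ₁, hσ₁⟩ : ∃ x : ℝ[X], x = ((∑ l, (X : ℝ[X]) ^ d l • (S l).map Polynomial.C) (Sum.inl 0) (Sum.inl 0) + (∑ l, (X : ℝ[X]) ^ d l • (S l).map Polynomial.C) (Sum.inl 1) (Sum.inl 1) + (∑ l, (X : ℝ[X]) ^ d l • (S l).map Polynomial.C) (Sum.inl 2) (Sum.inl 2)) := ⟨_, rfl⟩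
  obtain ⟨σ₂, hσ₂⟩ : ∃ x : ℝ[X], x = ((∑ l, (X : ℝ[X]) ^ d l • (S l).map Polynomial.C) (Sum.inl 0) (Sum.inl 0) * (∑ l, (X : ℝ[X]) ^ d l • (S l).map Polynomial.C) (Sum.inl 1) (Sum.inl 1) - (∑ l, (X : ℝ[X]) ^ d l • (S l).map Polynomial.C) (Sum.inl 0) (Sum.inl 1) * (∑ l, (X : ℝ[X]) ^ d l • (S l).map Polynomial.C) (Sum.inl 1) (Sum.inl 0) + (∑ l, (X : ℝ[X]) ^ d l • (S l).map Polynomial.C) (Sum.inl 0) (Sum.inl 0) * (∑ l, (X : ℝ[X]) ^ d l • (S l).map Polynomial.C) (Sum.inl 2) (Sum.inl 2) - (∑ l, (X : ℝ[X]) ^ d l • (S l).map Polynomial.C) (Sum.inl 0) (Sum.inl 2) * (∑ l, (X : ℝ[X]) ^ d l • (S l).map Polynomial.C) (Sum.inl 2) (Sum.inl 0) + (∑ l, (X : ℝ[X]) ^ d l • (S l).map Polynomial.C) (Sum.inl 1) (Sum.inl 1) * (∑ l, (X : ℝ[X]) ^ d l • (S l).map Polynomial.C) (Sum.inl 2) (Sum.inl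 2) - (∑ l, (X : ℝ[X]) ^ d l • (S l).map Polynomial.C) (Sum.inl 1) (Sum.inl 2) * (∑ l, (X : ℝ[X]) ^ d l • (S l).map Polynomial.C) (Sum.inl 2) (Sum.inl 1)) := ⟨_, rfl⟩
  obtain ⟨σ₃, hσ₃⟩ : ∃ x : ℝ[X], x = ((∑ l, (X : ℝ[X]) ^ d l • (S l).map Polynomial.C) (Sum.inl 0) (Sum.inl 0) * (∑ l, (X : ℝ[X]) ^ d l • (S l).map Polynomial.C) (Sum.inl 1) (Sum.inl 1) * (∑ l, (X : ℝ[X]) ^ d l • (S l).map Polynomial.C) (Sum.inl 2) (Sum.inl 2) - (∑ l, (X : ℝ[X]) ^ d l • (S l).map Polynomial.C) (Sum.inl 0) (Sum.inl 0) * (∑ l, (X : ℝ[X]) ^ d l • (S l).map Polynomial.C) (Sum.inl 1) (Sum.inl 2) * (∑ l, (X : ℝ[X]) ^ d l • (S l).map Polynomial.C) (Sum.inl 2) (Sum.inl 1) - (∑ l, (X : ℝ[X]) ^ d l • (S l).map Polynomial.C) (Sum.inl 0) (Sum.inl 1) * (∑ l, (X : ℝ[X]) ^ d l • (S l).map Polynomial.C)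 (Sum.inl 1) (Sum.inl 0) * (∑ l, (X : ℝ[X]) ^ d l • (S l).map Polynomial.C) (Sum.inl 2) (Sum.inl 2) + (∑ l, (X : ℝ[X]) ^ d l • (S l).map Polynomial.C) (Sum.inl 0) (Sum.inl 1) * (∑ l, (X : ℝ[X]) ^ d l • (S l).map Polynomial.C) (Sum.inl 1) (Sum.inl 2) * (∑ l, (X : ℝ[X]) ^ d l • (S l).map Polynomial.C) (Sum.inl 2) (Sum.inl 0) + (∑ l, (X : ℝ[X]) ^ d l • (S l).map Polynomial.C) (Sum.inl 0) (Sum.inl 2) * (∑ l, (X : ℝ[X]) ^ d l • (S l).map Polynomial.C) (Sum.inl 1) (Sum.inl 0) * (∑ l, (X : ℝ[X]) ^ d l • (S l).map Polynomial.C) (Sum.inl 2) (Sum.inl 1) - (∑ l, (X : ℝ[X]) ^ d l • (S l).map Polynomial.C) (Sum.inl 0) (Sum.inl 2) * (∑ l, (X : ℝ[X]) ^ d l • (S l).map Polynomial.C) (Sum.inl 1) (Sum.inl 1) * (∑ l, (X : ℝ[X]) ^ d l • (S l).map Polynomial.C) (Sum.inl 2) (Sum.inl 0)) := ⟨_, 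rfl⟩
  set Φ : MvPolynomial (Fin 2) ℝ := (∑ l, (MvPolynomial.X (0 : Fin 2) : MvPolynomial (Fin 2) ℝ) ^ d l •
              (S l).map (MvPolynomial.C : ℝ →+* MvPolynomial (Fin 2) ℝ)
            + (MvPolynomial.X (1 : Fin 2) : MvPolynomial (Fin 2) ℝ) •
              (Matrix.fromBlocks 1 0 0 0 : Matrix (Fin 3 ⊕ Fin 0) (Fin 3 ⊕ Fin 0) ℝ).map
                (MvPolynomial.C : ℝ →+* MvPolynomial (Fin 2) ℝ)).det with hΦdef
  have hΦ : Φ = MvPolynomial.X 1 * MvPolynomial.X 1 * MvPolynomial.X 1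
        + MvPolynomial.X 1 * MvPolynomial.X 1 * Polynomial.aeval (MvPolynomial.X 0 : MvPolynomial (Fin 2) ℝ) σ₁
        + MvPolynomial.X 1 * Polynomial.aeval (MvPolynomial.X 0 : MvPolynomial (Fin 2) ℝ) σ₂
        + Polynomial.aeval (MvPolynomial.X 0 : MvPolynomial (Fin 2) ℝ) σ₃ := by
    rw [hΦdef, hσ₁, hσ₂, hσ₃]; exact insertionPoly_three_zero K d S
  set osc := {p : Fin 2 → ℝ | 0 < p 0 ∧ 0 < p 1 ∧ MvPolynomial.eval p Φ = 0 ∧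
      MvPolynomial.eval p
        (MvPolynomial.X 0 * MvPolynomial.pderiv 0 (MvPolynomial.X 0 * MvPolynomial.pderiv 0 Φ)
            * (MvPolynomial.X 1 * MvPolynomial.pderiv 1 Φ) ^ 2
          - 2 * (MvPolynomial.X 0 * MvPolynomial.pderiv 0 (MvPolynomial.X 1 * MvPolynomial.pderiv 1 Φ))
            * (MvPolynomial.X 0 * MvPolynomial.pderiv 0 Φ) * (MvPolynomial.X 1 * MvPolynomial.pderiv 1 Φ)
          + MvPolynomial.X 1 * MvPolynomial.pderiv 1 (MvPolynomial.X 1 * MvPolynomial.pderiv 1 Φ)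
            * (MvPolynomial.X 0 * MvPolynomial.pderiv 0 Φ) ^ 2) = 0} with hosc
  have hreal : ∀ t : ℝ, ∃ μ₁ μ₂ μ₃ : ℝ, ∀ b : ℝ,
      b ^ 3 + b ^ 2 * σ₁.eval t + b * σ₂.eval t + σ₃.eval t = (b - μ₁) * (b - μ₂) * (b - μ₃) := by
    rw [hσ₁, hσ₂, hσ₃]; exact hreal_three_zero K d S hS
  have hpersist : ∀ t₀ b₀ : ℝ, 0 < b₀ → b₀ ^ 3 + b₀ ^ 2 * σ₁.eval t₀ + b₀ * σ₂.eval t₀ + σ₃.eval t₀ = 0 →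
      ∃ U : Set ℝ, IsOpen U ∧ t₀ ∈ U ∧ ∃ γ : ℝ → ℝ, ∀ t ∈ U, 0 < γ t ∧
        γ t ^ 3 + γ t ^ 2 * σ₁.eval t + γ t * σ₂.eval t + σ₃.eval t = 0 := by
    rw [hσ₁, hσ₂, hσ₃]; exact fun t₀ b₀ hb h => persist_three_zero K d S hS t₀ b₀ hb h
  -- supports of `σ₁, σ₂, σ₃`
  have h00 := OsculationTwoK.support_pencil_apply d S (Sum.inl 0) (Sum.inl 0)
  have h01 := OsculationTwoK.support_pencil_apply d S (Sum.inl 0) (Sum.inl 1)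
  have h02 := OsculationTwoK.support_pencil_apply d S (Sum.inl 0) (Sum.inl 2)
  have h10 := OsculationTwoK.support_pencil_apply d S (Sum.inl 1) (Sum.inl 0)
  have h11 := OsculationTwoK.support_pencil_apply d S (Sum.inl 1) (Sum.inl 1)
  have h12 := OsculationTwoK.support_pencil_apply d S (Sum.inl 1) (Sum.inl 2)
  have h20 := OsculationTwoK.support_pencil_apply d S (Sum.inl 2) (Sum.inl 0)
  have h21 := OsculationTwoK.support_pencil_apply d S (Sum.inl 2) (Sum.inl 1)
  have h22 := OsculationTwoK.support_pencil_apply d S (Sum.inl 2) (Sum.inl 2)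
  have hσ₁E : σ₁.support ⊆ 1 • Finset.univ.image d := by
    rw [hσ₁]; exact OsculationCusp.supp_add (OsculationCusp.supp_add h00 h11) h22
  have hσ₂E : σ₂.support ⊆ 2 • Finset.univ.image d := by
    rw [hσ₂]
    exact OsculationCusp.supp_cast (n := 2)
      (OsculationCusp.supp_sub (OsculationCusp.supp_add (OsculationCusp.supp_sub (OsculationCusp.supp_add
        (OsculationCusp.supp_sub (OsculationCusp.supp_mul h00 h11) (OsculationCusp.supp_mul h01 h10))
        (OsculationCusp.supp_mul h00 h22)) (OsculationCusp.supp_mul h02 h20)) (OsculationCusp.supp_mul h11 h22))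
        (OsculationCusp.supp_mul h12 h21)) rfl
  have hσ₃E : σ₃.support ⊆ 3 • Finset.univ.image d := by
    rw [hσ₃]
    exact OsculationCusp.supp_cast (n := 3)
      (OsculationCusp.supp_sub (OsculationCusp.supp_add (OsculationCusp.supp_add (OsculationCusp.supp_sub
        (OsculationCusp.supp_sub
          (OsculationCusp.supp_mul (OsculationCusp.supp_mul h00 h11) h22)
          (OsculationCusp.supp_mul (OsculationCusp.supp_mul h00 h12) h21))
          (OsculationCusp.supp_mul (OsculationCusp.supp_mul h01 h10) h22))
          (OsculationCusp.supp_mul (OsculationCusp.supp_mul h01 h12) h20))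
          (OsculationCusp.supp_mul (OsculationCusp.supp_mul h02 h10) h21))
          (OsculationCusp.supp_mul (OsculationCusp.supp_mul h02 h11) h20)) rfl
  refine (OsculationCuspCubic.cubic_curve_ncard_le σ₁ σ₂ σ₃
    (σ₁ ^ 6 * (X * derivative (X * derivative σ₁)) - σ₁ ^ 5 * (X * derivative σ₁) ^ 2 - σ₁ ^ 5 * (X * derivative (X * derivative σ₂)) - 7 * σ₁ ^ 4 * σ₂ * (X * derivative (X * derivative σ₁))
      + 4 * σ₁ ^ 4 * (X * derivative σ₁) * (X * derivative σ₂) + σ₁ ^ 4 * (X * derivative (X * derivative σ₃)) + 3 * σ₁ ^ 3 * σ₂ * (X * derivative σ₁) ^ 2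
      + 6 * σ₁ ^ 3 * σ₂ * (X * derivative (X * derivative σ₂)) + 8 * σ₁ ^ 3 * σ₃ * (X * derivative (X * derivative σ₁)) - 6 * σ₁ ^ 3 * (X * derivative σ₁) * (X * derivative σ₃)
      - 3 * σ₁ ^ 3 * (X * derivative σ₂) ^ 2 + 13 * σ₁ ^ 2 * σ₂ ^ 2 * (X * derivative (X * derivative σ₁)) - 12 * σ₁ ^ 2 * σ₂ * (X * derivative σ₁) * (X * derivative σ₂)
      - 5 * σ₁ ^ 2 * σ₂ * (X * derivative (X * derivative σ₃)) + σ₁ ^ 2 * σ₃ * (X * derivative σ₁) ^ 2 - 7 * σ₁ ^ 2 * σ₃ * (X * derivative (X * derivative σ₂))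
      + 8 * σ₁ ^ 2 * (X * derivative σ₂) * (X * derivative σ₃) - σ₁ * σ₂ ^ 2 * (X * derivative σ₁) ^ 2 - 8 * σ₁ * σ₂ ^ 2 * (X * derivative (X * derivative σ₂))
      - 22 * σ₁ * σ₂ * σ₃ * (X * derivative (X * derivative σ₁)) + 14 * σ₁ * σ₂ * (X * derivative σ₁) * (X * derivative σ₃) + 7 * σ₁ * σ₂ * (X * derivative σ₂) ^ 2
      + 4 * σ₁ * σ₃ * (X * derivative σ₁) * (X * derivative σ₂) + 6 * σ₁ * σ₃ * (X * derivative (X * derivative σ₃)) - 5 * σ₁ * (X * derivative σ₃) ^ 2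
      - 4 * σ₂ ^ 3 * (X * derivative (X * derivative σ₁)) + 4 * σ₂ ^ 2 * (X * derivative σ₁) * (X * derivative σ₂) + 4 * σ₂ ^ 2 * (X * derivative (X * derivative σ₃))
      - 3 * σ₂ * σ₃ * (X * derivative σ₁) ^ 2 + 12 * σ₂ * σ₃ * (X * derivative (X * derivative σ₂)) - 12 * σ₂ * (X * derivative σ₂) * (X * derivative σ₃)
      + 9 * σ₃ ^ 2 * (X * derivative (X * derivative σ₁)) - 6 * σ₃ * (X * derivative σ₁) * (X * derivative σ₃) - 3 * σ₃ * (X * derivative σ₂) ^ 2)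
    (σ₁ ^ 5 * σ₂ * (X * derivative (X * derivative σ₁)) - σ₁ ^ 4 * σ₂ * (X * derivative σ₁) ^ 2 - σ₁ ^ 4 * σ₂ * (X * derivative (X * derivative σ₂)) - σ₁ ^ 4 * σ₃ * (X * derivative (X * derivative σ₁))
      - 6 * σ₁ ^ 3 * σ₂ ^ 2 * (X * derivative (X * derivative σ₁)) + 4 * σ₁ ^ 3 * σ₂ * (X * derivative σ₁) * (X * derivative σ₂) + σ₁ ^ 3 * σ₂ * (X * derivative (X * derivative σ₃))
      + σ₁ ^ 3 * σ₃ * (X * derivative σ₁) ^ 2 + σ₁ ^ 3 * σ₃ * (X * derivative (X * derivative σ₂)) + 2 * σ₁ ^ 2 * σ₂ ^ 2 * (X * derivative σ₁) ^ 2 + 5 * σ₁ ^ 2 * σ₂ ^ 2 * (X * derivative (X * derivative σ₂))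
      + 12 * σ₁ ^ 2 * σ₂ * σ₃ * (X * derivative (X * derivative σ₁)) - 6 * σ₁ ^ 2 * σ₂ * (X * derivative σ₁) * (X * derivative σ₃) - 3 * σ₁ ^ 2 * σ₂ * (X * derivative σ₂) ^ 2
      - 4 * σ₁ ^ 2 * σ₃ * (X * derivative σ₁) * (X * derivative σ₂) - σ₁ ^ 2 * σ₃ * (X * derivative (X * derivative σ₃)) + 8 * σ₁ * σ₂ ^ 3 * (X * derivative (X * derivative σ₁))
      - 8 * σ₁ * σ₂ ^ 2 * (X * derivative σ₁) * (X * derivative σ₂) - 4 * σ₁ * σ₂ ^ 2 * (X * derivative (X * derivative σ₃)) + σ₁ * σ₂ * σ₃ * (X * derivative σ₁) ^ 2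
      - 10 * σ₁ * σ₂ * σ₃ * (X * derivative (X * derivative σ₂)) + 8 * σ₁ * σ₂ * (X * derivative σ₂) * (X * derivative σ₃) - 6 * σ₁ * σ₃ ^ 2 * (X * derivative (X * derivative σ₁))
      + 6 * σ₁ * σ₃ * (X * derivative σ₁) * (X * derivative σ₃) + 3 * σ₁ * σ₃ * (X * derivative σ₂) ^ 2 - 4 * σ₂ ^ 3 * (X * derivative (X * derivative σ₂))
      - 16 * σ₂ ^ 2 * σ₃ * (X * derivative (X * derivative σ₁)) + 8 * σ₂ ^ 2 * (X * derivative σ₁) * (X * derivative σ₃) + 4 * σ₂ ^ 2 * (X * derivative σ₂) ^ 2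
      + 4 * σ₂ * σ₃ * (X * derivative σ₁) * (X * derivative σ₂) + 12 * σ₂ * σ₃ * (X * derivative (X * derivative σ₃)) - 8 * σ₂ * (X * derivative σ₃) ^ 2
      - 3 * σ₃ ^ 2 * (X * derivative σ₁) ^ 2 + 9 * σ₃ ^ 2 * (X * derivative (X * derivative σ₂)) - 12 * σ₃ * (X * derivative σ₂) * (X * derivative σ₃))
    (σ₁ ^ 5 * σ₃ * (X * derivative (X * derivative σ₁)) - σ₁ ^ 4 * σ₃ * (X * derivative σ₁) ^ 2 - σ₁ ^ 4 * σ₃ * (X * derivative (X * derivative σ₂)) - 6 * σ₁ ^ 3 * σ₂ * σ₃ * (X * derivative (X * derivative σ₁))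
      + 4 * σ₁ ^ 3 * σ₃ * (X * derivative σ₁) * (X * derivative σ₂) + σ₁ ^ 3 * σ₃ * (X * derivative (X * derivative σ₃)) + 2 * σ₁ ^ 2 * σ₂ * σ₃ * (X * derivative σ₁) ^ 2
      + 5 * σ₁ ^ 2 * σ₂ * σ₃ * (X * derivative (X * derivative σ₂)) + 7 * σ₁ ^ 2 * σ₃ ^ 2 * (X * derivative (X * derivative σ₁)) - 6 * σ₁ ^ 2 * σ₃ * (X * derivative σ₁) * (X * derivative σ₃)
      - 3 * σ₁ ^ 2 * σ₃ * (X * derivative σ₂) ^ 2 + 8 * σ₁ * σ₂ ^ 2 * σ₃ * (X * derivative (X * derivative σ₁)) - 8 * σ₁ * σ₂ * σ₃ * (X * derivative σ₁) * (X * derivative σ₂)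
      - 4 * σ₁ * σ₂ * σ₃ * (X * derivative (X * derivative σ₃)) + 2 * σ₁ * σ₃ ^ 2 * (X * derivative σ₁) ^ 2 - 6 * σ₁ * σ₃ ^ 2 * (X * derivative (X * derivative σ₂))
      + 8 * σ₁ * σ₃ * (X * derivative σ₂) * (X * derivative σ₃) - 4 * σ₂ ^ 2 * σ₃ * (X * derivative (X * derivative σ₂)) - 12 * σ₂ * σ₃ ^ 2 * (X * derivative (X * derivative σ₁))
      + 8 * σ₂ * σ₃ * (X * derivative σ₁) * (X * derivative σ₃) + 4 * σ₂ * σ₃ * (X * derivative σ₂) ^ 2 + 9 * σ₃ ^ 2 * (X * derivative (X * derivative σ₃))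
      - 9 * σ₃ * (X * derivative σ₃) ^ 2)
    osc ?_ ?_ hreal hpersist hfin).trans
    (OsculationCuspCubic.bound_le_pow hEK hσ₁E hσ₂E hσ₃E
      (OsculationCuspCubic.supp_R2 σ₁ σ₂ σ₃ _ hσ₁E hσ₂E hσ₃E)
      (OsculationCuspCubic.supp_R1 σ₁ σ₂ σ₃ _ hσ₁E hσ₂E hσ₃E)
      (OsculationCuspCubic.supp_R0 σ₁ σ₂ σ₃ _ hσ₁E hσ₂E hσ₃E))
  · -- on the osculation set the Hessian condition is the quadratic `R₂b² + R₁b + R₀ = 0`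
    intro p hp
    rw [hosc, Set.mem_setOf_eq, OsculationCuspCubic.eval_logHessian_Phi3 σ₁ σ₂ σ₃ Φ hΦ p, hΦ,
      OsculationCuspCubic.eval_Phi3] at hp
    obtain ⟨h0, h1, hc, hH⟩ := hp
    exact ⟨h0, h1, hc, (OsculationCuspCubic.hess_reduce_poly3 σ₁ σ₂ σ₃ (p 0) (p 1) hc).1 hH⟩
  · -- conversely, positive points of the curve with `R₂b² + R₁b + R₀ = 0` osculate
    intro t b ht hb hc hq
    rw [hosc, Set.mem_setOf_eq, OsculationCuspCubic.eval_logHessian_Phi3 σ₁ σ₂ σ₃ Φ hΦ, hΦ,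
      OsculationCuspCubic.eval_Phi3]
    refine ⟨?_, ?_, ?_, ?_⟩
    · simpa [Matrix.cons_val_zero] using ht
    · simpa [Matrix.cons_val_one] using hb
    · simp only [Matrix.cons_val_zero, Matrix.cons_val_one]; exact hc
    · simp only [Matrix.cons_val_zero, Matrix.cons_val_one]
      exact (OsculationCuspCubic.hess_reduce_poly3 σ₁ σ₂ σ₃ t b hc).2 hq

end OsculationThreeK

end Summit.ValiantsHypothesis.ValiantsHypothesis.Theorems.LacunarySymmetroidMatrixDescartes
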